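import Summits.ValiantsHypothesis.ValiantsHypothesis.Theorems.MonotoneRestorationOrbitCompressionQPReducedSupport
import Summits.ValiantsHypothesis.ValiantsHypothesis.Theorems.MonotoneRestorationOrbitCompressionQPValueOrbitForm
import HarnessLib

/-!
# Route MonotoneRestoration — aside `OrbitCompressionQP` (stmt-ValiantsHypothesis-18332): QUASI-POLYNOMIAL
# ORBITS GIVE POLYLOG-SUPPORTED COMPUTATIONS; the aside in SUPPORT currency

The first half of the REPAIRED `stub_orbitToNarrowExpression` (line `expression_compression`), now with
genuine (not merely even) supports, by chaining the landed pieces: a square-symmetric circuit of orbit size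
`≤ 2^{(log₂ n + c)^c}` ⇒ (value derivation, reduced term circuit: `OrbitSupport.exists_reduced_of_qpOrbit`)
a REDUCED such circuit, orbit `≤ 2^{(log₂ n + c + 3)^{c+3}}` ⇒ (Dixon–Mortimer,
`OrbitSupport.evenSupport_of_orbitSize_lt_choose`, `n ≥ n₀(c)`) even supports of size `≤ (log₂ n + c + 3)^{c+3}`
⇒ (Dawar–Wilsenach induction on reduced circuits, `OrbitSupport.support_of_evenSupport_reduced`) SUPPORTS
⇒ (`OrbitSupport.exists_valueDerivation_fixedBy`) a value derivation of the output all of whose values are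
fixed by the pointwise stabiliser of `≤ (log₂ n + c + 3)^{c+3}` indices.

* `supportedDerivation_of_qpOrbit` — the statement just described (Dawar–Wilsenach's support theorem
  "orbits `2^{polylog}` ⇒ supports polylog", in VALUE currency, for the tree's unbundled circuits and `ORB`
  over all automorphisms);
* `supportedDerivations_of_qpOrbitFamily` — family form: the circuit hypothesis of `OrbitCompressionQP` /
  of the repaired Stub 1 yields, from some `n₀` on, computations of `f n` through polylog-SUPPORTED values;
* `orbitCompressionQP_iff_supportForm` — **the aside is equivalent to its support form**: every
  matrix-symmetric `VP` family that has, for one `c`, from some `n₀` on, SOME computation of `f n` (any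
  length) all of whose intermediate values are fixed by the pointwise stabilisers of `≤ (log₂ n + c)^c`
  indices, has square-symmetric circuits of quasi-polynomial SIZE.

What remains of the repaired Stub 1 is the EXTRACTION half (polylog-supported computation of a
matrix-symmetric `f n` ⇒ narrow closed bipartite pattern expression), whose one-sorted part Dawar–Pago–Seppelt
2025 leave open (p. 17 Remark, p. 45).  Helper file (`--supports stmt-ValiantsHypothesis-18332`); def-free;
nothing here is a named fact; the aside and Stub 2 stay open.
-/

noncomputable section

open scoped Classical

-- `Summit.ValiantsHypothesis.ValiantsHypothesis.…` is the tree's single-conjunct layout (Sub = Summit).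
set_option linter.dupNamespace false

namespace Summit.ValiantsHypothesis.ValiantsHypothesis.Theorems

namespace OrbitSupport

open Literature.Computability.AlgebraicComplexity MvPolynomial

/-- **QUASI-POLYNOMIAL ORBITS GIVE POLYLOG-SUPPORTED COMPUTATIONS** (Dawar–Wilsenach's support theorem in
value currency).  For every `c` there is `n₀` such that for `n ≥ n₀` every polynomial computed by a
square-symmetric circuit over `ℂ` of orbit size `≤ 2^{(log₂ n + c)^c}` has a value derivation (weighted sums
of any fan-in, binary products; any length) every value of which is fixed, under the diagonal action, by
every permutation fixing pointwise some set of at most `(log₂ n + c + 3)^{c+3}` indices.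
[cite: DawarWilsenach2025, §6 (Thms 6.2–6.3); DawarWilsenach2021, §4; DixonMortimer1996, Thm 5.2B] -/
theorem supportedDerivation_of_qpOrbit (c : ℕ) : ∃ n₀ : ℕ, ∀ n : ℕ, n₀ ≤ n →
    ∀ {G : Type} [Fintype G] (C : LabelledArithCircuit ℂ (Fin n × Fin n) Unit G),
      C.IsSymmetric (Equiv.Perm (Fin n)) →
      C.orbitSize (Equiv.Perm (Fin n)) ≤ 2 ^ ((Nat.log 2 n + c) ^ c) →
      ∃ 𝒟 : ValueDerivation ℂ (Fin n × Fin n), C.eval (C.output ()) ∈ 𝒟.S ∧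
        ∀ q ∈ 𝒟.S, ∃ X : Finset (Fin n), X.card ≤ (Nat.log 2 n + (c + 3)) ^ (c + 3) ∧
          ∀ ρ : Equiv.Perm (Fin n), (∀ x ∈ X, ρ x = x) → ren ρ q = q := by
  obtain ⟨n₀, hn₀⟩ := threshold (c + 3)
  refine ⟨n₀, fun n hn G _ C hC horb => ?_⟩
  obtain ⟨h8, h4, hch⟩ := hn₀ n hn
  set E : ℕ := (Nat.log 2 n + (c + 3)) ^ (c + 3) with hE
  -- a reduced circuit for the same polynomial
  obtain ⟨G', inst, C', hR, hC', hev, horb'⟩ := exists_reduced_of_qpOrbit C hC horb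
  -- even supports of size `≤ E` for all its gates
  have heven : ∀ g : G', ∃ X : Finset (Fin n), X.card ≤ E ∧ ∀ ρ : Equiv.Perm (Fin n),
      (∀ x ∈ X, ρ x = x) → Equiv.Perm.sign ρ = 1 →
        ∃ π : Equiv.Perm G', C'.IsAutomorphismExtending ρ π ∧ π g = g := by
    intro g
    obtain ⟨X, hXk, hX⟩ := evenSupport_of_orbitSize_lt_choose C' hC' h8 (Nat.succ_pos E) h4
      (horb'.trans_lt hch) g
    exact ⟨X, Nat.lt_succ_iff.1 hXk, hX⟩
  choose X hXcard hX using heven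
  -- hence supports (the circuit is reduced)
  have hsupp := support_of_evenSupport_reduced C' hR hC' (s := E) (by omega) X hXcard hX
  -- the value derivation of the reduced circuit
  obtain ⟨𝒟, hout, hfix⟩ := exists_valueDerivation_fixedBy C' (Γ := Equiv.Perm (Fin n))
  refine ⟨𝒟, hev ▸ hout, fun q hq => ?_⟩
  obtain ⟨g, hg⟩ := hfix q hq
  refine ⟨X g, hXcard g, fun ρ hρ => ?_⟩
  obtain ⟨π, hπ, hπg⟩ := hsupp g ρ hρ
  exact hg ρ π hπ hπg

/-- **Family form — the first half of the repaired Stub 1.**  The circuit hypothesis of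
`OrbitCompressionQP` (square-symmetric circuits of quasi-polynomial orbit size for `f`) yields, from some
`n₀` on, computations of `f n` through polylog-SUPPORTED values. [cite: DawarWilsenach2025, §6] -/
theorem supportedDerivations_of_qpOrbitFamily (f : (n : ℕ) → MvPolynomial (Fin n × Fin n) ℂ)
    (horb : ∃ c : ℕ, ∀ n : ℕ, ∃ (G : Type) (_ : Fintype G)
        (C : LabelledArithCircuit ℂ (Fin n × Fin n) Unit G),
      C.IsSymmetric (Equiv.Perm (Fin n)) ∧ C.eval (C.output ()) = f n ∧
      C.orbitSize (Equiv.Perm (Fin n)) ≤ 2 ^ ((Nat.log 2 n + c) ^ c)) :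
    ∃ c n₀ : ℕ, ∀ n : ℕ, n₀ ≤ n → ∃ 𝒟 : ValueDerivation ℂ (Fin n × Fin n), f n ∈ 𝒟.S ∧
      ∀ q ∈ 𝒟.S, ∃ X : Finset (Fin n), X.card ≤ (Nat.log 2 n + c) ^ c ∧
        ∀ ρ : Equiv.Perm (Fin n), (∀ x ∈ X, ρ x = x) → ren ρ q = q := by
  obtain ⟨c, hc⟩ := horb
  obtain ⟨n₀, hn₀⟩ := supportedDerivation_of_qpOrbit c
  refine ⟨c + 3, n₀, fun n hn => ?_⟩
  obtain ⟨G, inst, C, hC, hev, horb⟩ := hc n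
  obtain ⟨𝒟, hout, hX⟩ := hn₀ n hn C hC horb
  exact ⟨𝒟, hev ▸ hout, hX⟩

/-- **`OrbitCompressionQP` IS EQUIVALENT TO ITS SUPPORT FORM.**  The open content of the aside: compress a
polylog-SUPPORTED computation (any length) of a matrix-symmetric `VP` polynomial into a square-symmetric
circuit of quasi-polynomial size. [folklore] -/
theorem orbitCompressionQP_iff_supportForm :
    Theses.MonotoneRestoration.OrbitCompressionQP ↔
    ∀ f : (n : ℕ) → MvPolynomial (Fin n × Fin n) ℂ,
      (∀ (n : ℕ) (σ τ : Equiv.Perm (Fin n)),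
        MvPolynomial.rename (fun p : Fin n × Fin n => (σ p.1, τ p.2)) (f n) = f n) →
      IsVPFamily f →
      (∃ c n₀ : ℕ, ∀ n : ℕ, n₀ ≤ n → ∃ 𝒟 : ValueDerivation ℂ (Fin n × Fin n), f n ∈ 𝒟.S ∧
        ∀ q ∈ 𝒟.S, ∃ X : Finset (Fin n), X.card ≤ (Nat.log 2 n + c) ^ c ∧
          ∀ ρ : Equiv.Perm (Fin n), (∀ x ∈ X, ρ x = x) → ren ρ q = q) →
      ∃ c : ℕ, ∀ n : ℕ, ∃ (G : Type) (_ : Fintype G)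
        (C : LabelledArithCircuit ℂ (Fin n × Fin n) Unit G),
        C.IsSymmetric (Equiv.Perm (Fin n)) ∧ C.eval (C.output ()) = f n ∧
          Fintype.card G ≤ 2 ^ ((Nat.log 2 n + c) ^ c) := by
  constructor
  · rintro h f hsymm hVP ⟨c, n₀, hc⟩
    refine OrbitCompressionForms.orbitCompressionQP_iff_evenSupportForm.1 h f hsymm hVP ⟨c, n₀, ?_⟩
    intro n hn
    obtain ⟨𝒟, hf, hS⟩ := hc n hn
    refine ⟨𝒟, hf, fun q hq => ?_⟩
    obtain ⟨X, hXk, hX⟩ := hS q hq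
    exact ⟨X, hXk, fun ρ hρ _ => hX ρ hρ⟩
  · rintro h f hsymm hVP horb
    exact h f hsymm hVP (supportedDerivations_of_qpOrbitFamily f horb)

end OrbitSupport

end Summit.ValiantsHypothesis.ValiantsHypothesis.Theorems

end
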